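import Literature.Probability.RandomPlanarGeometry.HexSAWSurfaceWallRenewal
import Literature.Probability.RandomPlanarGeometry.HexSAWSurfaceWallRateSqrtMonotone
import HarnessLib

/-!
# Honeycomb SAW at a surface: the adsorbed growth rate is STRICTLY increasing in the surface fugacity,
# with an explicit local exponent — `(y'/y)^{1/m(y)} ≤ β(y')²/β(y)² ≤ y'/y` for `μ⁴ < y ≤ y'`

Topic `Literature/Probability/RandomPlanarGeometry` (lane pcv-sawmu, a-idea-1 door «STRICT-RATE»; lens: which structural
statements about the growth rate become provable WITH AN EXPLICIT RATE once a finite-data-certified inequality is in hand —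
here STRICT MONOTONICITY of the wall-bridge growth rate `β(y) = wallRate y` in the surface fugacity `y`, from Kesten's relation).

THE STATEMENT.  The tree knows that `β` is non-decreasing (`wallRate_mono`) and that `β(y)/√y` is non-increasing
(`wallRate_le_sqrt_mul`: `β(y')² ≤ (y'/y)·β(y)²`), i.e. the local exponent `d log β²/d log y` lies in `[0, 1]`.  In the explicit adsorbed
regime `y > μ⁴ = 2y_c²` of `HexSAWSurfaceWallRenewal` (Kesten's relation `Σ_s f_s(y) = 1`, `f_s(y) = Λ_{2s}(y) β(y)^{-2s}`, with
finite mean `m(y) = Σ_s s f_s(y)`) we prove the complementary LOWER bound on the exponent: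

  `log (y'/y) ≤ m(y) · log (β(y')²/β(y)²)`, i.e. `(y'/y)^{1/m(y)} ≤ β(y')²/β(y)²`, for all `μ⁴ < y ≤ y'`

(`log_div_le_pwbMean_mul_log`, `div_rpow_inv_pwbMean_le`), hence `β` is STRICTLY increasing on `(μ⁴, ∞)` (`strictMonoOn_wallRate`), the
two-sided sandwich `log(y'/y)/m(y) ≤ log(β(y')²/β(y)²) ≤ log(y'/y)` (`log_sq_wallRate_div_two_sided`), the fully explicit exponent
`1/M(y)`, `M(y) = 1 + μ⁴θ/(1−θ)²`, `θ = μ²/√y` (tree `pwbMean_le`; `log_div_le_explicit_mul_log`), and, given ANY uniform mean bound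
`m ≤ M₀` on `[y₀, ∞)` (a finite-data certificate; the tree's `pwbMean_le` at `y₀` together with monotonicity, or a sharper one), the
monotonicity of `log β(y)² − (log y)/M₀` on `[y₀, ∞)` (`monotoneOn_log_sq_wallRate_sub`) — the counterpart of the tree's antitone
`β(y)²/y`.  As `y₀ → ∞`, `M₀ → 1` and the two envelopes pinch: `β(y)² ≍ y` with exponent exactly `1` at infinity.

THE MECHANISM (two lines, no calculus).  (i) Every irreducible positive wall bridge has AT LEAST ONE visit (its endpoint lies on the
wall), so `Λ_{2k}(y) ≤ (y/y')·Λ_{2k}(y')` for `y ≤ y'` (`IPWB_le_div_mul_IPWB`).  (ii) Put `r := β(y)²/β(y')² ∈ (0, 1]`; then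
`Σ_k f_k(y) r^k = Σ_k Λ_{2k}(y) β(y')^{-2k} ≤ (y/y') Σ_k Λ_{2k}(y') β(y')^{-2k} = y/y'` by Kesten's relation AT `y'`, while by the tangent
inequality of the exponential (`e^{t₀}(1 + t − t₀) ≤ e^t`, i.e. Jensen for the law `f(y)` with mean `m(y)`, summed against the two
relations `Σ f_k = 1`, `Σ k f_k = m`) `Σ_k f_k(y) r^k ≥ r^{m(y)}` (`rpow_pwbMean_le_tsum_mul_pow`).  Hence `r^{m(y)} ≤ y/y'`.
In renewal language: the local exponent (the density of visits) is at least the density of RENEWALS `1/m(y)`, because every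
irreducible piece carries a visit — the discrete, finite-difference form of `∂ log β²/∂ log y = ⟨visits⟩/⟨half-length⟩ ≥ 1/m`.

MAIN RESULTS (`β = wallRate`, `m = pwbMean`, `μ = hexConnectiveConstant`, `θ = μ²/√y`):
* `one_le_visits_of_mem_pwb`, `IPWB_le_div_mul_IPWB` — (i);
* `rpow_pwbMean_le_tsum_mul_pow` — `r^{m(y)} ≤ Σ_k f_k(y) r^k` (`0 < r ≤ 1`) from the tangent inequality of the exponential;
* `tsum_pwbLaw_mul_pow_le_div` — `Σ_k f_k(y) (β(y)²/β(y')²)^k ≤ y/y'`;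
* `rpow_pwbMean_sq_wallRate_div_le` — ★ `(β(y)²/β(y')²)^{m(y)} ≤ y/y'`;
* `log_div_le_pwbMean_mul_log` — ★★ `log(y'/y) ≤ m(y)·log(β(y')²/β(y)²)`; `div_rpow_inv_pwbMean_le` — `(y'/y)^{1/m(y)} ≤ β(y')²/β(y)²`;
* `log_sq_wallRate_div_two_sided` — ★★ `log(y'/y)/m(y) ≤ log(β(y')²/β(y)²) ≤ log(y'/y)`;
* `wallRate_lt_wallRate`, `strictMonoOn_wallRate` — ★ `β` is strictly increasing on `(μ⁴, ∞)`;
* `log_div_le_explicit_mul_log` — the explicit exponent `1/M(y)`;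
* `monotoneOn_log_sq_wallRate_sub` — given `m ≤ M₀` on `[y₀,∞)`: `y ↦ log β(y)² − (log y)/M₀` is non-decreasing on `[y₀, ∞)`.

HONEST LABEL.  LANE THEOREM, explicit regime `y > μ⁴` only.  That the free energy of an adsorbing walk is a convex non-decreasing
function of `log y` whose derivative is the density of visits, zero in the desorbed and positive in the adsorbed phase, is classical
[HammersleyTorrieWhittington1982, §2; JansevanRensburg2000, §3.3, (3.17) and §5.4, Theorem 5.55 with the preceding paragraph; Madras2017, §1
(«a finite non-decreasing function … automatically convex»); BeatonBousquetMelouDeGierDuminilCopinGuttmann2014, §3.1, Proposition 5]; for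
PINNING models with an explicit renewal structure strict monotonicity and `f'(ζ) =` density of returns are standard [Hollander2009, §7.1,
Theorems 7.2–7.3 and (7.22), (7.26)].  NEW IN WRITING (modest): the quantitative finite-difference inequality `(y'/y)^{1/m(y)} ≤
β(y')²/β(y)²` — visit density bounded below by the renewal density — for the honeycomb surface model, derived from Kesten's relation
[MadrasSlade1993, §4.2, (4.2.4) (p. 91); Kesten1963SAW, §4] and Jensen's inequality without any differentiability, and the resulting
explicit strict monotonicity of `β` on `(μ⁴, ∞)`.  Print context searched (corpus fts + hybrid + vector, galaxy needles «positive density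
of visits|strictly increasing in the adsorbed|density of visits is positive»): only the qualitative statements above were found.  NOT
claimed: anything for `y ≤ μ⁴` (in particular nothing at or near `y_c = 1 + √2`), differentiability of `β`, the identification of the
exponent with the visit density as a theorem, numerics.
-/

noncomputable section

open Finset Filter Function
open Literature.Probability.LatticeModels
open _root_.Topology

namespace Literature.Probability.RandomPlanarGeometry.SAW.HexBW.Wall

variable {y y' : ℝ} {n : ℕ} {ω : ℕ → Site 2}

/-! ## 1. Every positive wall bridge of positive length visits the wall; two-fugacity comparison of `Λ_n` -/

/-- Every positive wall bridge of length `n ≥ 1` has at least one visit: its endpoint lies on the wall (`IsArch`).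
[cite: BeatonBousquetMelouDeGierDuminilCopinGuttmann2014, §3.1 (arXiv v5 p. 8: c(ω), the number of contacts with the surface)]
[cite: MadrasSlade1993, §1.2, Definition 1.2.4 (p. 11)] -/
theorem one_le_visits_of_mem_pwb (hn : 1 ≤ n) (hω : ω ∈ pwb n) : 1 ≤ visits n ω := by
  obtain ⟨hw, -⟩ := mem_pwb.1 hω
  obtain ⟨ha, -⟩ := mem_wbr.1 hw
  obtain ⟨-, hn2, hY⟩ := mem_archs.1 ha
  rw [visits_eq_card]
  refine Finset.one_le_card.2 ⟨n, ?_⟩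
  unfold wallTimes
  exact Finset.mem_filter.2 ⟨Finset.mem_Icc.2 ⟨hn, le_rfl⟩, hn2, hY⟩

/-- **Two fugacities**: `Λ_n(y) ≤ (y/y')·Λ_n(y')` for `0 < y ≤ y'` — every irreducible positive wall bridge carries at least one visit.
[cite: HammersleyTorrieWhittington1982, §2] [cite: MadrasSlade1993, §4.2, Definition 4.2.1 (p. 90)] -/
theorem IPWB_le_div_mul_IPWB (hy : 0 < y) (h : y ≤ y') (n : ℕ) : IPWB n y ≤ y / y' * IPWB n y' := by
  have hy' : 0 < y' := hy.trans_le h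
  unfold IPWB
  rw [Finset.mul_sum]
  refine Finset.sum_le_sum fun ω hω => ?_
  have hn : 1 ≤ n := (mem_ipwb.1 hω).2.1
  have hv : 1 ≤ visits n ω := one_le_visits_of_mem_pwb hn (ipwb_subset hω)
  obtain ⟨v, hv'⟩ : ∃ v, visits n ω = v + 1 := ⟨visits n ω - 1, by omega⟩
  rw [hv', pow_succ, pow_succ]
  have hyy : y' ≠ 0 := hy'.ne'
  calc y ^ v * y ≤ y' ^ v * y := mul_le_mul_of_nonneg_right (pow_le_pow_left₀ hy.le h v) hy.le
    _ = y / y' * (y' ^ v * y') := by field_simp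

/-! ## 2. Jensen for the renewal law: `r^{m(y)} ≤ Σ_k f_k(y) r^k` -/

/-- Convexity of the exponential at `t₀`: `e^{t₀}·(1 + (t − t₀)) ≤ e^t`.
[cite: Feller1968, XIII.3 (generating functions of a renewal law; convexity)] -/
private theorem exp_mul_one_add_sub_le_exp_sr (t t₀ : ℝ) : Real.exp t₀ * (1 + (t - t₀)) ≤ Real.exp t := by
  have h := Real.add_one_le_exp (t - t₀)
  calc Real.exp t₀ * (1 + (t - t₀)) ≤ Real.exp t₀ * Real.exp (t - t₀) :=
        mul_le_mul_of_nonneg_left (by linarith) (Real.exp_pos _).le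
    _ = Real.exp t := by rw [← Real.exp_add]; ring_nf

/-- **Jensen's inequality for the first-renewal law** `f(y)` (mean `m(y)`): `r^{m(y)} ≤ Σ_k f_k(y) r^k` for `0 < r ≤ 1` (`y > μ⁴`).
Proof: sum the tangent inequality `r^{m}(1 + (k − m) log r) ≤ r^k` against `Σ f_k = 1`, `Σ k f_k = m`.
[cite: Feller1968, XIII.3, Theorem 1 (a persistent renewal law has total mass 1) and XIII.10] [cite: MadrasSlade1993, §4.2, (4.2.4) (p. 91)] -/
theorem rpow_pwbMean_le_tsum_mul_pow (hy : hexConnectiveConstant ^ 4 < y) {r : ℝ} (hr : 0 < r) (hr1 : r ≤ 1) :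
    r ^ pwbMean y ≤ ∑' k : ℕ, pwbLaw y k * r ^ k := by
  have hμ := hexConnectiveConstant_pos
  have hy0 : 0 < y := lt_of_le_of_lt (by positivity) hy
  have hf1 := hasSum_pwbLaw hy
  have hfm : HasSum (fun k : ℕ => (k : ℝ) * pwbLaw y k) (pwbMean y) := (summable_mul_pwbLaw hy).hasSum
  set L := Real.log r with hL
  set m := pwbMean y with hm
  -- the comparison sequence `g_k = r^m (f_k + L (k f_k − m f_k))`, with sum `r^m (1 + L (m − m)) = r^m`
  have hg : HasSum (fun k : ℕ => r ^ m * (pwbLaw y k + L * ((k : ℝ) * pwbLaw y k - m * pwbLaw y k))) (r ^ m) := by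
    have h := ((hf1.add ((hfm.sub (hf1.mul_left m)).mul_left L)).mul_left (r ^ m))
    simp only [mul_one, sub_self, mul_zero, add_zero] at h
    exact h
  -- summability of `f_k r^k ≤ f_k`
  have hS : Summable fun k : ℕ => pwbLaw y k * r ^ k :=
    Summable.of_nonneg_of_le (fun k => mul_nonneg (pwbLaw_nonneg hy0.le k) (pow_nonneg hr.le k))
      (fun k => mul_le_of_le_one_right (pwbLaw_nonneg hy0.le k) (pow_le_one₀ hr.le hr1)) hf1.summable
  refine hasSum_le (fun k => ?_) hg hS.hasSum
  -- pointwise: `r^m (f + L (k f − m f)) = f · (r^m (1 + (kL − mL))) ≤ f · r^k`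
  have hrk : (r : ℝ) ^ k = Real.exp ((k : ℝ) * L) := by
    rw [← Real.rpow_natCast, Real.rpow_def_of_pos hr, mul_comm]
  have hrm : r ^ m = Real.exp (m * L) := by rw [Real.rpow_def_of_pos hr, mul_comm]
  have htan := exp_mul_one_add_sub_le_exp_sr ((k : ℝ) * L) (m * L)
  have hf0 := pwbLaw_nonneg hy0.le k
  calc r ^ m * (pwbLaw y k + L * ((k : ℝ) * pwbLaw y k - m * pwbLaw y k))
      = pwbLaw y k * (Real.exp (m * L) * (1 + ((k : ℝ) * L - m * L))) := by rw [hrm]; ring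
    _ ≤ pwbLaw y k * Real.exp ((k : ℝ) * L) := mul_le_mul_of_nonneg_left htan hf0
    _ = pwbLaw y k * r ^ k := by rw [hrk]

/-! ## 3. Kesten's relation at two fugacities: `(β(y)²/β(y')²)^{m(y)} ≤ y/y'` -/

/-- `Σ_k f_k(y)·(β(y)²/β(y')²)^k = Σ_k Λ_{2k}(y) β(y')^{-2k} ≤ (y/y')·Σ_k f_k(y') = y/y'` for `μ⁴ < y ≤ y'` (Kesten's relation at `y'`).
[cite: MadrasSlade1993, §4.2, (4.2.4) (p. 91: Σ λ_k μ^{-k} = 1)] [cite: Kesten1963SAW, §4] -/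
theorem tsum_pwbLaw_mul_pow_le_div (hy : hexConnectiveConstant ^ 4 < y) (h : y ≤ y') :
    ∑' k : ℕ, pwbLaw y k * (wallRate y ^ 2 / wallRate y' ^ 2) ^ k ≤ y / y' := by
  have hμ := hexConnectiveConstant_pos
  have hy0 : 0 < y := lt_of_le_of_lt (by positivity) hy
  have hy'μ : hexConnectiveConstant ^ 4 < y' := lt_of_lt_of_le hy h
  have hy'0 : 0 < y' := hy0.trans_le h
  have hβ := wallRate_pos y
  have hβ' := wallRate_pos y'
  set r := wallRate y ^ 2 / wallRate y' ^ 2 with hr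
  have hr0 : 0 < r := by positivity
  have hr1 : r ≤ 1 := by
    rw [hr, div_le_one (by positivity)]
    exact pow_le_pow_left₀ hβ.le (wallRate_mono hy0 h) 2
  -- pointwise identity and bound
  have hpt : ∀ k : ℕ, pwbLaw y k * r ^ k ≤ y / y' * pwbLaw y' k := fun k => by
    have hk : pwbLaw y k * r ^ k = IPWB (2 * k) y / wallRate y' ^ (2 * k) := by
      rw [hr, div_pow, ← pow_mul, ← pow_mul, pwbLaw]
      field_simp
    rw [hk, pwbLaw, ← mul_div_assoc]
    exact div_le_div_of_nonneg_right (IPWB_le_div_mul_IPWB hy0 h (2 * k)) (pow_pos hβ' _).le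
  have hS : Summable fun k : ℕ => pwbLaw y k * r ^ k :=
    Summable.of_nonneg_of_le (fun k => mul_nonneg (pwbLaw_nonneg hy0.le k) (pow_nonneg hr0.le k))
      (fun k => mul_le_of_le_one_right (pwbLaw_nonneg hy0.le k) (pow_le_one₀ hr0.le hr1)) (hasSum_pwbLaw hy).summable
  have hS' := (hasSum_pwbLaw hy'μ).mul_left (y / y')
  rw [mul_one] at hS'
  exact hasSum_le hpt hS.hasSum hS'

/-- ★ **`(β(y)²/β(y')²)^{m(y)} ≤ y/y'`** for `μ⁴ < y ≤ y'` (real power; `m(y) = pwbMean y ≥ 1`).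
[cite: MadrasSlade1993, §4.2, (4.2.4) (p. 91)] [cite: Hollander2009, §7.1, Theorem 7.3(a) and (7.26) (free-energy derivative = density of pinned monomers)] -/
theorem rpow_pwbMean_sq_wallRate_div_le (hy : hexConnectiveConstant ^ 4 < y) (h : y ≤ y') :
    (wallRate y ^ 2 / wallRate y' ^ 2) ^ pwbMean y ≤ y / y' := by
  have hμ := hexConnectiveConstant_pos
  have hy0 : 0 < y := lt_of_le_of_lt (by positivity) hy
  have hβ := wallRate_pos y
  have hβ' := wallRate_pos y'
  have hr0 : 0 < wallRate y ^ 2 / wallRate y' ^ 2 := by positivity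
  have hr1 : wallRate y ^ 2 / wallRate y' ^ 2 ≤ 1 := by
    rw [div_le_one (by positivity)]
    exact pow_le_pow_left₀ hβ.le (wallRate_mono hy0 h) 2
  exact (rpow_pwbMean_le_tsum_mul_pow hy hr0 hr1).trans (tsum_pwbLaw_mul_pow_le_div hy h)

/-! ## 4. The local exponent is at least `1/m(y)`: logarithmic and power forms, strict monotonicity -/

/-- ★★ **`log (y'/y) ≤ m(y) · log (β(y')²/β(y)²)`** for `μ⁴ < y ≤ y'`: the growth rate increases at least like `y^{1/m(y)}` locally.
[cite: HammersleyTorrieWhittington1982, §2] [cite: JansevanRensburg2000, §3.3, (3.17) (the log-derivative of the free energy is the energy density)]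
[cite: MadrasSlade1993, §4.2, (4.2.4) (p. 91)] -/
theorem log_div_le_pwbMean_mul_log (hy : hexConnectiveConstant ^ 4 < y) (h : y ≤ y') :
    Real.log (y' / y) ≤ pwbMean y * Real.log (wallRate y' ^ 2 / wallRate y ^ 2) := by
  have hμ := hexConnectiveConstant_pos
  have hy0 : 0 < y := lt_of_le_of_lt (by positivity) hy
  have hy'0 : 0 < y' := hy0.trans_le h
  have hβ := wallRate_pos y
  have hβ' := wallRate_pos y'
  have hm := pwbMean_pos hy
  have hr0 : 0 < wallRate y ^ 2 / wallRate y' ^ 2 := by positivity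
  have h1 := rpow_pwbMean_sq_wallRate_div_le hy h
  have h2 := Real.log_le_log (Real.rpow_pos_of_pos hr0 _) h1
  rw [Real.log_rpow hr0] at h2
  have h3 : Real.log (wallRate y' ^ 2 / wallRate y ^ 2) = -Real.log (wallRate y ^ 2 / wallRate y' ^ 2) := by
    rw [← Real.log_inv, inv_div]
  have h4 : Real.log (y' / y) = -Real.log (y / y') := by rw [← Real.log_inv, inv_div]
  rw [h3, h4]
  nlinarith

/-- `(y'/y)^{1/m(y)} ≤ β(y')²/β(y)²` for `μ⁴ < y ≤ y'` (power form of `log_div_le_pwbMean_mul_log`).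
[cite: HammersleyTorrieWhittington1982, §2] [cite: MadrasSlade1993, §4.2, (4.2.4) (p. 91)] -/
theorem div_rpow_inv_pwbMean_le (hy : hexConnectiveConstant ^ 4 < y) (h : y ≤ y') :
    (y' / y) ^ (pwbMean y)⁻¹ ≤ wallRate y' ^ 2 / wallRate y ^ 2 := by
  have hμ := hexConnectiveConstant_pos
  have hy0 : 0 < y := lt_of_le_of_lt (by positivity) hy
  have hy'0 : 0 < y' := hy0.trans_le h
  have hβ := wallRate_pos y
  have hβ' := wallRate_pos y'
  have hm := pwbMean_pos hy
  have hq : 0 < y' / y := by positivity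
  have hR : 0 < wallRate y' ^ 2 / wallRate y ^ 2 := by positivity
  have h1 := log_div_le_pwbMean_mul_log hy h
  have h2 : (pwbMean y)⁻¹ * Real.log (y' / y) ≤ Real.log (wallRate y' ^ 2 / wallRate y ^ 2) := by
    rw [inv_mul_le_iff₀ hm]
    exact h1
  calc (y' / y) ^ (pwbMean y)⁻¹ = Real.exp ((pwbMean y)⁻¹ * Real.log (y' / y)) := by
        rw [Real.rpow_def_of_pos hq, mul_comm]
    _ ≤ Real.exp (Real.log (wallRate y' ^ 2 / wallRate y ^ 2)) := Real.exp_le_exp.2 h2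
    _ = wallRate y' ^ 2 / wallRate y ^ 2 := Real.exp_log hR

/-- ★★ **Two-sided local exponent**: `log(y'/y)/m(y) ≤ log(β(y')²/β(y)²) ≤ log(y'/y)` for `μ⁴ < y ≤ y'` (upper: tree `wallRate_le_sqrt_mul`).
[cite: BeatonBousquetMelouDeGierDuminilCopinGuttmann2014, §3.1, Proposition 5 (arXiv v5 p. 9: non-decreasing, log-convex; p. 10: μ(y) ∼ √y)]
[cite: HammersleyTorrieWhittington1982, §2] [cite: MadrasSlade1993, §4.2, (4.2.4) (p. 91)] -/
theorem log_sq_wallRate_div_two_sided (hy : hexConnectiveConstant ^ 4 < y) (h : y ≤ y') :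
    Real.log (y' / y) / pwbMean y ≤ Real.log (wallRate y' ^ 2 / wallRate y ^ 2) ∧
      Real.log (wallRate y' ^ 2 / wallRate y ^ 2) ≤ Real.log (y' / y) := by
  have hμ := hexConnectiveConstant_pos
  have hy0 : 0 < y := lt_of_le_of_lt (by positivity) hy
  have hy'0 : 0 < y' := hy0.trans_le h
  have hβ := wallRate_pos y
  have hβ' := wallRate_pos y'
  have hm := pwbMean_pos hy
  refine ⟨?_, ?_⟩
  · rw [div_le_iff₀ hm, mul_comm]
    exact log_div_le_pwbMean_mul_log hy h
  · have hu := wallRate_le_sqrt_mul hy0 h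
    have hq : 0 ≤ y' / y := by positivity
    have hsq : wallRate y' ^ 2 ≤ y' / y * wallRate y ^ 2 := by
      calc wallRate y' ^ 2 ≤ (Real.sqrt (y' / y) * wallRate y) ^ 2 :=
            pow_le_pow_left₀ hβ'.le hu 2
        _ = y' / y * wallRate y ^ 2 := by rw [mul_pow, Real.sq_sqrt hq]
    have hR : wallRate y' ^ 2 / wallRate y ^ 2 ≤ y' / y := by
      rw [div_le_iff₀ (by positivity)]
      exact hsq
    exact Real.log_le_log (by positivity) hR

/-- ★ **Strict monotonicity**: `μ⁴ < y < y' → β(y) < β(y')`.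
[cite: HammersleyTorrieWhittington1982, §2] [cite: JansevanRensburg2000, §5.4, Theorem 5.55 and the preceding paragraph (desorbed: zero density of visits; adsorbed: positive density)]
[cite: Madras2017, §1 (desorbed regime `F(β) = F(0)`, adsorbed regime `F(β) > F(0)`)] -/
theorem wallRate_lt_wallRate (hy : hexConnectiveConstant ^ 4 < y) (h : y < y') : wallRate y < wallRate y' := by
  have hμ := hexConnectiveConstant_pos
  have hy0 : 0 < y := lt_of_le_of_lt (by positivity) hy
  have hy'0 : 0 < y' := hy0.trans h
  have hβ := wallRate_pos y
  have hβ' := wallRate_pos y'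
  have hm := pwbMean_pos hy
  have h1 := log_div_le_pwbMean_mul_log hy h.le
  have hpos : 0 < Real.log (y' / y) := Real.log_pos (by rw [lt_div_iff₀ hy0, one_mul]; exact h)
  by_contra hle
  have hle' : wallRate y' ≤ wallRate y := le_of_not_gt hle
  have hR1 : wallRate y' ^ 2 / wallRate y ^ 2 ≤ 1 := by
    rw [div_le_one (by positivity)]
    exact pow_le_pow_left₀ hβ'.le hle' 2
  have hlog : Real.log (wallRate y' ^ 2 / wallRate y ^ 2) ≤ 0 := Real.log_nonpos (by positivity) hR1
  nlinarith

/-- ★ `β = wallRate` is strictly increasing on `(μ⁴, ∞)`.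
[cite: HammersleyTorrieWhittington1982, §2] [cite: JansevanRensburg2000, §5.4, Theorem 5.55 and the preceding paragraph] -/
theorem strictMonoOn_wallRate : StrictMonoOn wallRate (Set.Ioi (hexConnectiveConstant ^ 4)) :=
  fun _ hy _ _ h => wallRate_lt_wallRate hy h

/-! ## 5. Explicit exponents: `1/M(y)` pointwise, and `1/M₀` uniformly on `[y₀, ∞)` given a mean certificate -/

/-- The explicit exponent: `log(y'/y) ≤ M(y)·log(β(y')²/β(y)²)`, `M(y) = 1 + μ⁴θ/(1−θ)²`, `θ = μ²/√y` (tree `pwbMean_le`), for `μ⁴ < y ≤ y'`.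
[cite: MadrasSlade1993, §4.2, Theorem 4.2.2 (pp. 91–92)] [cite: Feller1968, XIII.10, Theorem 1 (renewal theorem with finite mean)] -/
theorem log_div_le_explicit_mul_log (hy : hexConnectiveConstant ^ 4 < y) (h : y ≤ y') :
    Real.log (y' / y) ≤ (1 + hexConnectiveConstant ^ 4 *
      ((hexConnectiveConstant ^ 2 / Real.sqrt y) / (1 - hexConnectiveConstant ^ 2 / Real.sqrt y) ^ 2)) *
        Real.log (wallRate y' ^ 2 / wallRate y ^ 2) := by
  have hμ := hexConnectiveConstant_pos
  have hy0 : 0 < y := lt_of_le_of_lt (by positivity) hy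
  have hβ := wallRate_pos y
  have hβ' := wallRate_pos y'
  have h1 := log_div_le_pwbMean_mul_log hy h
  have hR : 1 ≤ wallRate y' ^ 2 / wallRate y ^ 2 := by
    rw [le_div_iff₀ (by positivity), one_mul]
    exact pow_le_pow_left₀ hβ.le (wallRate_mono hy0 h) 2
  have hlog : 0 ≤ Real.log (wallRate y' ^ 2 / wallRate y ^ 2) := Real.log_nonneg hR
  exact h1.trans (mul_le_mul_of_nonneg_right (pwbMean_le hy) hlog)

/-- **Uniform exponent from a mean certificate.**  If `m(y) ≤ M₀` for all `y ≥ y₀` (`y₀ > μ⁴`, `M₀ > 0`), then for `y₀ ≤ y ≤ y'`: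
`log(y'/y) ≤ M₀ · log(β(y')²/β(y)²)`.
[cite: HammersleyTorrieWhittington1982, §2] [cite: MadrasSlade1993, §4.2, (4.2.4) and Theorem 4.2.2 (pp. 91–92)] -/
theorem log_div_le_mul_log_of_pwbMean_le {y₀ M₀ : ℝ} (hy₀ : hexConnectiveConstant ^ 4 < y₀)
    (hM : ∀ y, y₀ ≤ y → pwbMean y ≤ M₀) (hy : y₀ ≤ y) (h : y ≤ y') :
    Real.log (y' / y) ≤ M₀ * Real.log (wallRate y' ^ 2 / wallRate y ^ 2) := by
  have hμ := hexConnectiveConstant_pos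
  have hyμ : hexConnectiveConstant ^ 4 < y := lt_of_lt_of_le hy₀ hy
  have hy0 : 0 < y := lt_of_le_of_lt (by positivity) hyμ
  have hβ := wallRate_pos y
  have hβ' := wallRate_pos y'
  have h1 := log_div_le_pwbMean_mul_log hyμ h
  have hR : 1 ≤ wallRate y' ^ 2 / wallRate y ^ 2 := by
    rw [le_div_iff₀ (by positivity), one_mul]
    exact pow_le_pow_left₀ hβ.le (wallRate_mono hy0 h) 2
  have hlog : 0 ≤ Real.log (wallRate y' ^ 2 / wallRate y ^ 2) := Real.log_nonneg hR
  exact h1.trans (mul_le_mul_of_nonneg_right (hM y hy) hlog)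

/-- ★ **`log β(y)² − (log y)/M₀` is non-decreasing on `[y₀, ∞)`** whenever `m ≤ M₀` on `[y₀, ∞)` (`y₀ > μ⁴`, `M₀ > 0`) — the counterpart of
the tree's non-increasing `β(y)²/y`; as `y₀ → ∞` one may take `M₀ → 1`.
[cite: BeatonBousquetMelouDeGierDuminilCopinGuttmann2014, §3.1, Proposition 5 (arXiv v5 p. 9)] [cite: HammersleyTorrieWhittington1982, §2]
[cite: MadrasSlade1993, §4.2, (4.2.4) (p. 91)] -/
theorem monotoneOn_log_sq_wallRate_sub {y₀ M₀ : ℝ} (hy₀ : hexConnectiveConstant ^ 4 < y₀) (hM0 : 0 < M₀)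
    (hM : ∀ y, y₀ ≤ y → pwbMean y ≤ M₀) :
    MonotoneOn (fun y => Real.log (wallRate y ^ 2) - Real.log y / M₀) (Set.Ici y₀) := by
  intro y hy y' _ h
  have hμ := hexConnectiveConstant_pos
  have hyμ : hexConnectiveConstant ^ 4 < y := lt_of_lt_of_le hy₀ hy
  have hy0 : 0 < y := lt_of_le_of_lt (by positivity) hyμ
  have hy'0 : 0 < y' := hy0.trans_le h
  have hβ := wallRate_pos y
  have hβ' := wallRate_pos y'
  have h1 := log_div_le_mul_log_of_pwbMean_le hy₀ hM hy h
  rw [Real.log_div hy'0.ne' hy0.ne', Real.log_div (by positivity) (by positivity)] at h1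
  have h2 : (Real.log y' - Real.log y) / M₀ ≤ Real.log (wallRate y' ^ 2) - Real.log (wallRate y ^ 2) := by
    rw [div_le_iff₀ hM0, mul_comm]
    exact h1
  show Real.log (wallRate y ^ 2) - Real.log y / M₀ ≤ Real.log (wallRate y' ^ 2) - Real.log y' / M₀
  rw [sub_div] at h2
  linarith

end Literature.Probability.RandomPlanarGeometry.SAW.HexBW.Wall
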